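import Literature.Computability.Complexity.CHSums
import Literature.Computability.Complexity.CHPrimes
import HarnessLib

/-!
# A formula layer over the counting-hierarchy calculus: bundled `CH`-graph functions, relations, bounded quantifiers, sums and counts

Fourth toolkit file (theorems, plus one bundling structure) of the scaled-up `FOM + MAJ` calculus
of `CHFunctions.lean` / `CHCounting.lean` / `CHSums.lean` (Bürgisser, ECCC TR06-113, §3;
Torán 1991, §4; Allender–Wagner 1993, §3: "`CH` is closed under first-order definitions with
majority/counting quantifiers"). The earlier files state every rule on PAIRED words
(`{z | f (fstP z) = val (sndP z)}`, `boolPair x (bin v) ∈ L`), so that a consumer assembling a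
formula with several quantifiers and atoms re-derives the pairing bookkeeping at every step
(cf. the proofs of `CHPrimes.genTest_mem_CH`). This file packages the rules in ENVIRONMENT form —
every object is a function or predicate of the current word `w`; binding a variable `v < 2^{p|w|}`
passes to the word `⟨w, bin v⟩`, read back through `fstP`/`sndP` — with conclusions stated as plain
set-builders, so that each step of a first-order definition is one lemma application:

* `IsCHFn f` — `f : {0,1}* → ℕ` has a `CH` graph and polynomial bit-size (the pair of hypotheses
  `hf`, `hb` of the earlier files, bundled); constructors `of_FP` (values of `FP` string functions),
  `const`, `val`, `comp_FP`, `add`, `mul`, `tsub`, `div`, `mod`, `pow2` (of a polynomially bounded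
  exponent), `ite`, `indicator`, and **`sum`** (`w ↦ Σ_{v < 2^{p|w|}} g w v` for a `CH`-graph
  family `g` with a uniform bound — the sum rule `sumGraph_mem_CH`) and **`count`**;
* relations between such functions are `CH` predicates: `lt_mem_CH`, `le_mem_CH`, `eq_mem_CH`;
  atoms on `FP` terms are in `P` (`fpLt_mem_P`, `fpEq_mem_P`, …);
* connectives in set-builder form (`and_mem_CH`, `or_mem_CH`, `not_mem_CH`, `imp_mem_CH`) and the
  **bounded quantifiers in environment form** `forall_lt_mem_CH'`, `exists_lt_mem_CH'`
  (`{w | ∀ v < 2^{p|w|}, Φ w v} ∈ CH` from `{z | Φ (fstP z) (val (sndP z))} ∈ CH`).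

No named facts. Consumer: the counting-hierarchy formulas for the moments of a quantum oracle
machine's acceptance polynomial (Aaronson–Ambainis 2014, proof of Thm. 23).

## References

* P. Bürgisser, *On defining integers in the counting hierarchy and proving lower bounds in
  algebraic complexity*, ECCC TR06-113 (2006), §2.1, §3.
* J. Torán, *Complexity classes defined by counting quantifiers*, J. ACM 38 (1991) 753–774, §4.
* E. Allender, K. W. Wagner, *Counting hierarchies: polynomial time and constant depth circuits*
  (1993), §3.
-/

namespace Literature.Computability.Complexity

open _root_.Computability Polynomial PRelSigma TTClosure Brick PPSharpP ThresholdPP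

/-! ### Polynomial bounds -/

/-- Polynomials over `ℕ` are monotone (re-export in the form used here). [folklore] -/
theorem poly_eval_mono (p : Polynomial ℕ) {a b : ℕ} (h : a ≤ b) : p.eval a ≤ p.eval b := TM2Iter.eval_mono p h

/-- `2^{p} + 2^{q} ≤ 2^{p + q + 1}`. [folklore] -/
private theorem two_pow_add_two_pow_le' (a b : ℕ) : 2 ^ a + 2 ^ b ≤ 2 ^ (a + b + 1) := by
  have ha : 2 ^ a ≤ 2 ^ (a + b) := Nat.pow_le_pow_right (by norm_num) (by omega)
  have hb : 2 ^ b ≤ 2 ^ (a + b) := Nat.pow_le_pow_right (by norm_num) (by omega)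
  rw [pow_succ]; omega

/-! ### Bundled `CH`-graph functions -/

/-- **A `CH`-definable number-valued function of strings**: its graph `{⟨w, ν⟩ | f w = val ν}` is in
`CH` and its values have polynomial bit-size (Bürgisser 2006, Def. 3.1 / Rem. 3.2, the two
hypotheses of every rule of `CHFunctions.lean`, bundled). [cite: Burgisser2006, Remark 3.2] -/
structure IsCHFn (f : List Bool → ℕ) : Prop where
  /-- the graph is a `CH` language -/
  graph : {z | f (fstP z) = bitsToNat (sndP z)} ∈ CH
  /-- polynomial bit-size -/
  bound : ∃ p : Polynomial ℕ, ∀ w, f w < 2 ^ p.eval w.length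

namespace IsCHFn

variable {f g : List Bool → ℕ}

/-- **Values of `FP` string functions.** [cite: Burgisser2006, Remark 3.2] -/
theorem of_FP {t : List Bool → List Bool} (ht : t ∈ FP) : IsCHFn fun w => bitsToNat (t w) :=
  ⟨graphFP_mem_CH ht, exists_val_lt_of_mem_FP ht⟩

/-- The value of the word itself. [folklore] -/
theorem val : IsCHFn fun w => bitsToNat w := ⟨graphVal_mem_CH, ⟨X, val_lt_two_pow_eval_X⟩⟩

/-- Constants. [folklore] -/
theorem const (c : ℕ) : IsCHFn fun _ : List Bool => c :=
  ⟨mem_CH_of_iff (P_subset_CH (preimage_mem_P (valEqConst_mem_P c) sndP_mem_FP)) _ fun z => by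
      change c = bitsToNat (sndP z) ↔ bitsToNat (sndP z) = c; exact eq_comm,
    ⟨C c, fun w => by rw [eval_C]; exact Nat.lt_two_pow_self⟩⟩

/-- **Precomposition with an `FP` map.** [folklore] -/
theorem comp_FP (hf : IsCHFn f) {t : List Bool → List Bool} (ht : t ∈ FP) : IsCHFn fun w => f (t w) := by
  obtain ⟨p, hp⟩ := hf.bound
  obtain ⟨s, hs⟩ := exists_poly_length_le_of_mem_FP ht
  exact ⟨graph_comp_FP_mem_CH hf.graph ht, ⟨p.comp s, bound_comp_FP hp hs⟩⟩

/-- Binary composition with a `P`-graph operation, bundled. [cite: Toran1991, §4] -/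
theorem comp₂ {op : ℕ → ℕ → ℕ}
    (hop : ({u | op (bitsToNat (fstP (fstP u))) (bitsToNat (sndP (fstP u))) = bitsToNat (sndP u)} : Language Bool) ∈ CH)
    (hbd : ∃ r : Polynomial ℕ, ∀ a b pa pb : ℕ, a < 2 ^ pa → b < 2 ^ pb → op a b < 2 ^ r.eval (pa + pb))
    (hf : IsCHFn f) (hg : IsCHFn g) : IsCHFn fun w => op (f w) (g w) := by
  obtain ⟨p, hp⟩ := hf.bound
  obtain ⟨q, hq⟩ := hg.bound
  obtain ⟨r, hr⟩ := hbd
  refine ⟨comp₂_graph_mem_CH hop hf.graph hp hg.graph hq, ⟨r.comp (p + q), fun w => ?_⟩⟩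
  rw [eval_comp, eval_add]
  exact hr _ _ _ _ (hp w) (hq w)

/-- **Sum.** [cite: Toran1991, §4] -/
theorem add (hf : IsCHFn f) (hg : IsCHFn g) : IsCHFn fun w => f w + g w :=
  comp₂ (P_subset_CH addGraph_mem_P) ⟨X + 1, fun a b pa pb ha hb => by
    rw [eval_add, eval_X, eval_one]
    exact (add_lt_add ha hb).trans_le (two_pow_add_two_pow_le' pa pb)⟩ hf hg

/-- **Product.** [cite: Toran1991, §4] -/
theorem mul (hf : IsCHFn f) (hg : IsCHFn g) : IsCHFn fun w => f w * g w :=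
  comp₂ (P_subset_CH mulGraph_mem_P) ⟨X, fun a b pa pb ha hb => by
    rw [eval_X, pow_add]; exact Nat.mul_lt_mul'' ha hb⟩ hf hg

/-- **Truncated difference.** [cite: Toran1991, §4] -/
theorem tsub (hf : IsCHFn f) (hg : IsCHFn g) : IsCHFn fun w => f w - g w :=
  comp₂ (P_subset_CH subGraph_mem_P) ⟨X, fun a b pa pb ha _ => by
    rw [eval_X]; exact (Nat.sub_le a b).trans_lt (ha.trans_le (Nat.pow_le_pow_right (by norm_num) (by omega)))⟩ hf hg

/-- **Quotient.** [cite: Toran1991, §4] -/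
theorem div (hf : IsCHFn f) (hg : IsCHFn g) : IsCHFn fun w => f w / g w :=
  comp₂ (P_subset_CH divGraph_mem_P) ⟨X, fun a b pa pb ha _ => by
    rw [eval_X]; exact (Nat.div_le_self a b).trans_lt (ha.trans_le (Nat.pow_le_pow_right (by norm_num) (by omega)))⟩ hf hg

/-- **Remainder.** [cite: Toran1991, §4] -/
theorem mod (hf : IsCHFn f) (hg : IsCHFn g) : IsCHFn fun w => f w % g w :=
  comp₂ (P_subset_CH modGraph_mem_P) ⟨X, fun a b pa pb ha _ => by
    rw [eval_X]; exact (Nat.mod_le a b).trans_lt (ha.trans_le (Nat.pow_le_pow_right (by norm_num) (by omega)))⟩ hf hg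

/-- **Power of two of a polynomially bounded exponent.** [cite: Burgisser2006, §3 (proof of Thm. 3.7)] -/
theorem pow2 (hf : IsCHFn f) (hle : ∃ p : Polynomial ℕ, ∀ w, f w ≤ p.eval w.length) : IsCHFn fun w => 2 ^ f w := by
  obtain ⟨p, hp⟩ := hf.bound
  obtain ⟨q, hq⟩ := hle
  exact ⟨comp₁_graph_mem_CH pow2Graph_mem_CH hf.graph hp, ⟨q + 1, fun w => by
    rw [eval_add, eval_one]; exact Nat.pow_lt_pow_right (by norm_num) (Nat.lt_succ_of_le (hq w))⟩⟩

/-- **Definition by cases** on a `CH` predicate. [cite: Toran1991, §4] -/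
theorem ite {Q : List Bool → Prop} [DecidablePred Q] (hQ : ({w | Q w} : Language Bool) ∈ CH) (hf : IsCHFn f) (hg : IsCHFn g) :
    IsCHFn fun w => if Q w then f w else g w := by
  obtain ⟨p, hp⟩ := hf.bound
  obtain ⟨q, hq⟩ := hg.bound
  refine ⟨iteGraph_mem_CH' hQ hf.graph hg.graph, ⟨p + q, fun w => ?_⟩⟩
  rw [eval_add]
  split_ifs
  · exact (hp w).trans_le (Nat.pow_le_pow_right (by norm_num) (by omega))
  · exact (hq w).trans_le (Nat.pow_le_pow_right (by norm_num) (by omega))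

/-- **Indicator** of a `CH` predicate. [cite: Toran1991, §4] -/
theorem indicator {Q : List Bool → Prop} [DecidablePred Q] (hQ : ({w | Q w} : Language Bool) ∈ CH) :
    IsCHFn fun w => if Q w then 1 else 0 :=
  ite hQ (const 1) (const 0)

/-! ### Relations between `CH`-graph functions -/

/-- **`{w | f w < g w} ∈ CH`.** [cite: Toran1991, §4] -/
theorem lt_mem_CH (hf : IsCHFn f) (hg : IsCHFn g) : ({w | f w < g w} : Language Bool) ∈ CH := by
  obtain ⟨p, hp⟩ := hf.bound
  obtain ⟨q, hq⟩ := hg.bound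
  -- substitute `g` into `{⟨w, ν⟩ | f w < val ν}`
  have h1 : {z | f (fstP z) < bitsToNat (sndP z)} ∈ CH := ltGraph_mem_CH hf.graph hp
  have h2 := rel_apply_mem_CH (f := g) (preimage_mem_CH h1 (pairFn_mem_FP sndP_mem_FP fstP_mem_FP)) hg.graph hq
    (PolyTimeComputable.id _)
  refine mem_CH_of_iff h2 _ fun w => ?_
  change f w < g w ↔ f (fstP (pairFn sndP fstP (boolPair (encodeNat (g (id w))) w))) <
    bitsToNat (sndP (pairFn sndP fstP (boolPair (encodeNat (g (id w))) w)))
  simp only [pairFn_apply, fstP_boolPair, sndP_boolPair, bitsToNat_encodeNat, id]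

/-- **`{w | f w ≤ g w} ∈ CH`.** [cite: Toran1991, §4] -/
theorem le_mem_CH (hf : IsCHFn f) (hg : IsCHFn g) : ({w | f w ≤ g w} : Language Bool) ∈ CH :=
  mem_CH_of_iff (compl_mem_CH (lt_mem_CH hg hf)) _ fun w => by
    rw [memL_compl]; change f w ≤ g w ↔ ¬ g w < f w; exact Nat.not_lt.symm

/-- **`{w | f w = g w} ∈ CH`.** [cite: Toran1991, §4] -/
theorem eq_mem_CH (hf : IsCHFn f) (hg : IsCHFn g) : ({w | f w = g w} : Language Bool) ∈ CH :=
  mem_CH_of_iff (inter_mem_CH (le_mem_CH hf hg) (le_mem_CH hg hf)) _ fun w => by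
    rw [memL_inf']; change f w = g w ↔ f w ≤ g w ∧ g w ≤ f w; exact Nat.le_antisymm_iff

end IsCHFn

/-! ### Connectives in set-builder form -/

section Connectives

variable {A B : List Bool → Prop}

/-- Conjunction. [folklore] -/
theorem and_mem_CH (hA : ({w | A w} : Language Bool) ∈ CH) (hB : ({w | B w} : Language Bool) ∈ CH) :
    ({w | A w ∧ B w} : Language Bool) ∈ CH :=
  mem_CH_of_iff (inter_mem_CH hA hB) _ fun w => by rw [memL_inf']; rfl

/-- Disjunction. [folklore] -/
theorem or_mem_CH (hA : ({w | A w} : Language Bool) ∈ CH) (hB : ({w | B w} : Language Bool) ∈ CH) :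
    ({w | A w ∨ B w} : Language Bool) ∈ CH :=
  mem_CH_of_iff (union_mem_CH hA hB) _ fun w => by rw [memL_sup]; rfl

/-- Negation. [folklore] -/
theorem not_mem_CH (hA : ({w | A w} : Language Bool) ∈ CH) : ({w | ¬ A w} : Language Bool) ∈ CH :=
  mem_CH_of_iff (compl_mem_CH hA) _ fun w => by rw [memL_compl]; rfl

/-- Implication. [folklore] -/
theorem imp_mem_CH (hA : ({w | A w} : Language Bool) ∈ CH) (hB : ({w | B w} : Language Bool) ∈ CH) :
    ({w | A w → B w} : Language Bool) ∈ CH :=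
  mem_CH_of_iff (or_mem_CH (not_mem_CH hA) hB) _ fun w => by
    change (A w → B w) ↔ ¬ A w ∨ B w; exact imp_iff_not_or

/-- Equivalence of two predicates. [folklore] -/
theorem iff_mem_CH (hA : ({w | A w} : Language Bool) ∈ CH) (hB : ({w | B w} : Language Bool) ∈ CH) :
    ({w | (A w ↔ B w)} : Language Bool) ∈ CH :=
  mem_CH_of_iff (and_mem_CH (imp_mem_CH hA hB) (imp_mem_CH hB hA)) _ fun w => by
    change (A w ↔ B w) ↔ (A w → B w) ∧ (B w → A w); exact iff_iff_implies_and_implies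

/-- Precomposition of a predicate with an `FP` map. [folklore] -/
theorem pred_comp_FP_mem_CH (hA : ({w | A w} : Language Bool) ∈ CH) {t : List Bool → List Bool} (ht : t ∈ FP) :
    ({w | A (t w)} : Language Bool) ∈ CH :=
  preimage_mem_CH hA ht

/-- Equality of two Booleans computed by `CH` predicates (`decide`). [folklore] -/
theorem decide_eq_decide_mem_CH [DecidablePred A] [DecidablePred B]
    (hA : ({w | A w} : Language Bool) ∈ CH) (hB : ({w | B w} : Language Bool) ∈ CH) :
    ({w | decide (A w) = decide (B w)} : Language Bool) ∈ CH :=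
  mem_CH_of_iff (iff_mem_CH hA hB) _ fun w => by
    change decide (A w) = decide (B w) ↔ (A w ↔ B w)
    by_cases ha : A w <;> by_cases hb : B w <;> simp [ha, hb]

end Connectives

/-! ### Atoms on `FP` terms are in `P` -/

section Atoms

variable {s t : List Bool → List Bool}

/-- `{w | val (s w) < val (t w)} ∈ P`. [folklore] -/
theorem fpLt_mem_P (hs : s ∈ FP) (ht : t ∈ FP) : ({w | bitsToNat (s w) < bitsToNat (t w)} : Language Bool) ∈ Classes.P :=
  mem_P_of_iff (preimage_mem_P ltVal_mem_P (pairFn_mem_FP hs ht)) _ fun w => by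
    change bitsToNat (s w) < bitsToNat (t w) ↔ bitsToNat (fstP (pairFn s t w)) < bitsToNat (sndP (pairFn s t w))
    rw [pairFn_apply, fstP_boolPair, sndP_boolPair]

/-- `{w | val (s w) ≤ val (t w)} ∈ P`. [folklore] -/
theorem fpLe_mem_P (hs : s ∈ FP) (ht : t ∈ FP) : ({w | bitsToNat (s w) ≤ bitsToNat (t w)} : Language Bool) ∈ Classes.P :=
  mem_P_of_iff (preimage_mem_P leVal_mem_P (pairFn_mem_FP hs ht)) _ fun w => by
    change bitsToNat (s w) ≤ bitsToNat (t w) ↔ bitsToNat (fstP (pairFn s t w)) ≤ bitsToNat (sndP (pairFn s t w))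
    rw [pairFn_apply, fstP_boolPair, sndP_boolPair]

/-- `{w | val (s w) = val (t w)} ∈ P`. [folklore] -/
theorem fpEqVal_mem_P (hs : s ∈ FP) (ht : t ∈ FP) : ({w | bitsToNat (s w) = bitsToNat (t w)} : Language Bool) ∈ Classes.P :=
  mem_P_of_iff (preimage_mem_P eqVal_mem_P (pairFn_mem_FP hs ht)) _ fun w => by
    change bitsToNat (s w) = bitsToNat (t w) ↔ bitsToNat (fstP (pairFn s t w)) = bitsToNat (sndP (pairFn s t w))
    rw [pairFn_apply, fstP_boolPair, sndP_boolPair]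

/-- `{w | s w = t w} ∈ P` (string equality). [folklore] -/
theorem fpEq_mem_P (hs : s ∈ FP) (ht : t ∈ FP) : ({w | s w = t w} : Language Bool) ∈ Classes.P :=
  setOf_apply_eq_apply_mem_P hs ht

/-- `{w | s w = c} ∈ P` (a fixed string). [folklore] -/
theorem fpEqConst_mem_P (hs : s ∈ FP) (c : List Bool) : ({w | s w = c} : Language Bool) ∈ Classes.P :=
  setOf_apply_eq_apply_mem_P hs (const_mem_FP c)

/-- A one-bit `FP` test. [folklore] -/
theorem fpTest_mem_CH (hs : s ∈ FP) : ({w | s w = [true]} : Language Bool) ∈ CH := P_subset_CH (fpEqConst_mem_P hs _)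

end Atoms

/-! ### Bounded quantifiers, environment form -/

section Quantifiers

variable {Φ : List Bool → ℕ → Prop}

/-- **Bounded universal quantifier**: from `{⟨w, bin v⟩-words z | Φ (fstP z) (val (sndP z))} ∈ CH`
to `{w | ∀ v < 2^{p|w|}, Φ w v} ∈ CH`. [cite: Toran1991, §4] -/
theorem forall_lt_mem_CH' (p : Polynomial ℕ) (h : ({z | Φ (fstP z) (bitsToNat (sndP z))} : Language Bool) ∈ CH) :
    ({w | ∀ v < 2 ^ p.eval w.length, Φ w v} : Language Bool) ∈ CH :=
  mem_CH_of_iff (forall_lt_mem_CH h p) _ fun w => by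
    change (∀ v < 2 ^ p.eval w.length, Φ w v) ↔
      ∀ v < 2 ^ p.eval w.length, Φ (fstP (boolPair w (encodeNat v))) (bitsToNat (sndP (boolPair w (encodeNat v))))
    simp only [fstP_boolPair, sndP_boolPair, bitsToNat_encodeNat]

/-- **Bounded existential quantifier**, environment form. [cite: Toran1991, §4] -/
theorem exists_lt_mem_CH' (p : Polynomial ℕ) (h : ({z | Φ (fstP z) (bitsToNat (sndP z))} : Language Bool) ∈ CH) :
    ({w | ∃ v < 2 ^ p.eval w.length, Φ w v} : Language Bool) ∈ CH :=
  mem_CH_of_iff (exists_lt_mem_CH h p) _ fun w => by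
    change (∃ v < 2 ^ p.eval w.length, Φ w v) ↔
      ∃ v < 2 ^ p.eval w.length, Φ (fstP (boolPair w (encodeNat v))) (bitsToNat (sndP (boolPair w (encodeNat v))))
    simp only [fstP_boolPair, sndP_boolPair, bitsToNat_encodeNat]

/-- **Universal quantifier over a `CH`-definable range**: `{w | ∀ v < N w, Φ w v} ∈ CH` for a
`CH`-graph bound `N`. [cite: Toran1991, §4] -/
theorem forall_lt_fn_mem_CH {N : List Bool → ℕ} (hN : IsCHFn N)
    (h : ({z | Φ (fstP z) (bitsToNat (sndP z))} : Language Bool) ∈ CH) :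
    ({w | ∀ v < N w, Φ w v} : Language Bool) ∈ CH := by
  obtain ⟨p, hp⟩ := hN.bound
  -- `∀ v < 2^{p|w|}, v < N w → Φ w v`
  have hlt : ({z | bitsToNat (sndP z) < N (fstP z)} : Language Bool) ∈ CH :=
    IsCHFn.lt_mem_CH (IsCHFn.of_FP sndP_mem_FP) (hN.comp_FP fstP_mem_FP)
  refine mem_CH_of_iff (forall_lt_mem_CH' (Φ := fun w v => v < N w → Φ w v) p (imp_mem_CH hlt h)) _ fun w => ?_
  change (∀ v < N w, Φ w v) ↔ ∀ v < 2 ^ p.eval w.length, v < N w → Φ w v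
  exact ⟨fun H v _ hv => H v hv, fun H v hv => H v (hv.trans (hp w)) hv⟩

/-- **Existential quantifier over a `CH`-definable range.** [cite: Toran1991, §4] -/
theorem exists_lt_fn_mem_CH {N : List Bool → ℕ} (hN : IsCHFn N)
    (h : ({z | Φ (fstP z) (bitsToNat (sndP z))} : Language Bool) ∈ CH) :
    ({w | ∃ v < N w, Φ w v} : Language Bool) ∈ CH := by
  have := not_mem_CH (forall_lt_fn_mem_CH (Φ := fun w v => ¬ Φ w v) hN (not_mem_CH h))
  refine mem_CH_of_iff this _ fun w => ?_
  change (∃ v < N w, Φ w v) ↔ ¬ ∀ v < N w, ¬ Φ w v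
  simp only [not_forall, not_not, exists_prop]

end Quantifiers

/-! ### Sums and counts, environment form -/

section Sums

variable {g : List Bool → ℕ → ℕ}

/-- **The sum rule, environment form**: if `(w, v) ↦ g w v` is a `CH`-graph function of the word
`⟨w, bin v⟩` with a bound uniform in `v`, then `w ↦ Σ_{v < 2^{p|w|}} g w v` is a `CH`-graph
function. [cite: Burgisser2006, Theorem 3.7 (proof)] -/
theorem IsCHFn.sum (p : Polynomial ℕ) (hg : IsCHFn fun z => g (fstP z) (bitsToNat (sndP z)))
    (hb : ∃ q : Polynomial ℕ, ∀ w v, g w v < 2 ^ q.eval w.length) :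
    IsCHFn fun w => ∑ v ∈ Finset.range (2 ^ p.eval w.length), g w v := by
  obtain ⟨q, hq⟩ := hb
  have hb' : ∀ z, (fun z => g (fstP z) (bitsToNat (sndP z))) z < 2 ^ q.eval z.length := fun z =>
    (hq _ _).trans_le (Nat.pow_le_pow_right (by norm_num) (poly_eval_mono q (length_fstP_le z)))
  have hG := sumGraph_mem_CH hg.graph hb' p
  refine ⟨mem_CH_of_iff hG _ fun z => ?_, ⟨p + q.comp (2 * X + 2 + p), fun w => ?_⟩⟩
  · change (∑ v ∈ Finset.range (2 ^ p.eval (fstP z).length), g (fstP z) v) = bitsToNat (sndP z) ↔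
      (∑ i ∈ Finset.range (2 ^ p.eval (fstP z).length),
        g (fstP (boolPair (fstP z) (encodeNat i))) (bitsToNat (sndP (boolPair (fstP z) (encodeNat i))))) = bitsToNat (sndP z)
    simp only [fstP_boolPair, sndP_boolPair, bitsToNat_encodeNat]
  · have := sum_lt_two_pow hb' p w
    simp only [fstP_boolPair, sndP_boolPair, bitsToNat_encodeNat] at this
    exact this

/-- **Counting, environment form**: `w ↦ #{v < 2^{p|w|} | Φ w v}` is a `CH`-graph function for a
`CH` predicate `Φ` of `⟨w, bin v⟩` (the sum of its indicator). [cite: Toran1991, §4] -/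
theorem IsCHFn.count {Φ : List Bool → ℕ → Prop} [∀ w, DecidablePred (Φ w)] (p : Polynomial ℕ)
    (h : ({z | Φ (fstP z) (bitsToNat (sndP z))} : Language Bool) ∈ CH) :
    IsCHFn fun w => ((Finset.range (2 ^ p.eval w.length)).filter (Φ w)).card := by
  have hs := IsCHFn.sum (g := fun w v => if Φ w v then 1 else 0) p (IsCHFn.indicator h) ⟨C 1, fun w v => by
    rw [eval_C]; split_ifs <;> norm_num⟩
  refine ⟨mem_CH_of_iff hs.graph _ fun z => ?_, ?_⟩
  · change ((Finset.range (2 ^ p.eval (fstP z).length)).filter (Φ (fstP z))).card = bitsToNat (sndP z) ↔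
      (∑ v ∈ Finset.range (2 ^ p.eval (fstP z).length), if Φ (fstP z) v then 1 else 0) = bitsToNat (sndP z)
    rw [Finset.sum_boole, Nat.cast_id]
  · obtain ⟨q, hq⟩ := hs.bound
    exact ⟨q, fun w => by have := hq w; rwa [Finset.sum_boole, Nat.cast_id] at this⟩

end Sums

end Literature.Computability.Complexity
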